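import Summits.QuantumFields.BalabanUV.T4Continuum.Support.CovariantSliceComplement
import Summits.QuantumFields.BalabanUV.T4Continuum.Support.RegularLaplacianRelativeBound

/-!
# T⁴ programme, spine node NE2 (U1a), lane P2 — toward (GF3) WITH BACKGROUND FOR COVARIANT FRAMES: THE FLAT SLICE SUBSPACE `S_1(ker Q′_1)` IS
# ONE-SIDEDLY `δ₀`-CLOSE TO THE COVARIANT ONE `S_R(ker Q_{T′})` FOR EVERY UNITARY FRAME FIELD `T′` WITH `‖T′ − 1‖ ≤ τ` — proved THROUGH THE COMPLEMENT
# `S_R(ker Q_{T′})ᗮ`, where `T′` is never differentiated (model level; regular small gauge `‖R − 1‖ ≤ a`, `‖R(x,μ) − R(x−e_μ,μ)‖ ≤ ℓ`; general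
# finite-dimensional Hilbert `E`)

NE2 formalisation swarm `b2b-balaban-t4-ne2-formalise-*`, leaf prover 04 GEN 6 (`prover-b2b-balaban-t4-ne2-formalise-leaf-04-g6-0`); journal INTENT
CLAIMS.log l.18848 «(GF3) WITH BACKGROUND FOR COVARIANT FRAMES — THE SLICE GAP THROUGH THE COMPLEMENT».  On top of leaf-03-g6's `CovariantSliceComplement`
(p227590: `eq_transport_blockConst_of_orth_ker`, `norm_eq_of_orth_ker`, `inBlock_lip_of_orth_ker`, `ipv_lapOp_eq_zero_of_mem_orthogonal`, `ipv_transport_blockConst`,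
`nsqv_negLapv_le`), `CovariantBlockReversePoincare` (p227349: `reversePoincare`, `revPC`), `RegularLaplacianRelativeBound` (`nsqv_negLapv_sub_flat_le`,
`dirichlet_le_of_ker`) and leaf-09-g7's `VariationalVectorGaugeSlice.{sliceSub, avgOp, lapOp}` (p221888) — BY NAME.

WHY (memo `t4/T4-EST-NE2-P2-REG.md` §4, kit j102549).  (GF3) for Bałaban's projected gauge functional `projG R K W = ‖Π_{S_R(K)} div_R W‖²` is kernel at
`U = 1` ((1.90), `VariationalVectorGaugeSliceB5`) and transfers to a regular small background once `S_R(K) = div_R D_R(K)` is close to `S_1(ker Q′_1) =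
Δ(ker Q′_1)`.  For the flat frame (`K = ker Q′_1`) a relative bound ON `K` does it (`RegularLaplacianRelativeBound`); for COVARIANT frames `T′` (transport
to the block base point) `K = ker Q_{T′} = T′⋆·ker Q′_1` and every primal comparison `div_R D_R(T′⋆k)` vs `Δk` differentiates `T′`, whose `O(α)` jumps
across block faces make the relative bound grow like `n^{3/2}` — while the gap is measured n-uniform.  HERE the gap is proved n-uniformly by DUALITY: on
`S_R(ker Q_{T′})ᗮ`, `div_R D_R s = x ↦ T′(x)⋆ c(block x)` with `n⁴‖div_R D_R s‖² ≤ C₁²‖s‖²`, `n²Σ_μ‖D_R s‖² ≤ C₁‖s‖²` (reverse Poincaré, KERNEL WITH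
BACKGROUND), so `Δ s = c(block ·) + r`, `n²‖r‖ ≤ (τ·C₁ + √E₁)·‖s‖`, `c(block ·) ⊥ ker Q′_1`, and `‖k‖ ≤ 4n²‖Δk‖` on `ker Q′_1`: `Re⟪s, Δk⟫ ≤ δ₀·‖s‖·‖Δk‖`.

THE STATEMENTS ([folklore]; level `n ≥ 1`, coarse torus `Tor M`, fine torus `Tor (fine n M)`; unitary `R` with `‖R − 1‖ ≤ a`, `‖R(x,μ) − R(x−e_μ,μ)‖ ≤ ℓ`;
unitary `T′` with `‖T′ − 1‖ ≤ τ` and the in-block mismatch class `‖R(x,μ)T′(x+e_μ)⋆T′(x) − 1‖ ≤ w`; `α := na`, `λ := n²ℓ`, `C₁ := revPC d n w = 4d·36^d(1 + nw)²`).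
 * §1 on `S_R(ker Q_{T′})ᗮ`: `dirichletR_le_of_orth` (`n²·Σ_μ nsqv (D^R_μ s) ≤ C₁·nsqv s`), `nsqv_lapR_le_of_orth` (`n⁴·nsqv (div_R D_R s) ≤ C₁²·nsqv s`),
   `dirichletFlat_le` (`Σ_μ nsqv (D¹_μ s) ≤ 2Σ_μ nsqv (D^R_μ s) + 2d·a²·nsqv s`, every `s`), **`nsqv_lapSubFlat_le_of_orth`** (`n⁴·nsqv ((div_R D_R − Δ) s) ≤
   E₁·nsqv s`, `E₁ = gapE d n a ℓ w := 12dα²C₁ + 12d²α⁴ + 3d²(α² + λ)²`), `nsqv_sub_blockConst_le_of_orth` (`nsqv (div_R D_R s − c(block ·)) ≤ τ²·nsqv (div_R D_R s)`,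
   `c = Q_{T′}(div_R D_R s)`), `ipv_blockConst_eq_zero` (`c(block ·) ⊥ ker Q′_1`).
 * §2 **`re_inner_lapFlat_le_of_orth`**: `toLp s ∈ S_R(ker Q_{T′})ᗮ`, `Q′_1 k = 0` ⟹ `Re⟪toLp s, toLp (Δk)⟫ ≤ δ₀·‖toLp s‖·‖toLp (Δk)‖`,
   `δ₀ = deltaGap d n a ℓ τ w := 4·(τ·C₁ + √E₁)`.
 * §3 **`sliceFlat_close_covariant`** (THE END): `∀ y ∈ S_1(ker Q′_1), ‖y − Π_{S_R(ker Q_{T′})} y‖ ≤ δ₀·‖y‖` — the `h` hypothesis of leaf-03-g6's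
   `SubspacePairPerturbation.norm_sub_starProjection_le_of_oneSided` with `S := S_1(ker Q′_1)`, `S′ := S_R(ker Q_{T′})`, UNIFORM in `n` in the classes
   `na ≤ α₀`, `n²ℓ ≤ λ₀`, `nw ≤ w₀`, `τ ≤ τ₀`; that ONE one-sided closeness gives both `‖Π_{S_Rᗮ}v‖ ≤ ‖Π_{S_1ᗮ}v‖ + δ₀‖v‖` and `‖Π_{S_1}v‖ ≤ ‖Π_{S_R}v‖ +
   δ₀‖v‖` — all the (GF3) transfer consumes (next file).
NOT HERE: the (GF3) assembly (`E = ℂ`); any gauge-covariance statement; the other one-sided gap; a dimension count.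

HONEST FRAMING (T4-DAG p. 1).  Rung (B)+1 only — NOT infinite volume, NOT a mass gap, NOT Clay.  NE2 is NOT IN PRINT and NOT proved here.  MODEL LEVEL
(c5): `R` is DATA presented in a regular small gauge on the whole fine torus, `T′` is DATA; nothing of Bałaban's `R_k(U)` is identified.  OURS and
elementary ([folklore]); nothing printed is a hypothesis; two constant `def`s (`gapE`, `deltaGap`), no `def … : Prop`, no `sorry`; axioms standard.  The
constant is explicit but large (`C₁ = 4d·36^d(1+nw)²` enters `δ₀` linearly).  V-END with background ∕ NE2 NOT proved; NE3 OPEN; spine PROVED 0∕9.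
HONEST DEPENDENCY (cell, verbatim): continuum YM on T⁴ ⇐ BetaPertH ∧ nine spine estimates (0/9 proved); BetaPertH ⇐ (D1) ∧ (D4) ∧ CAP+tail; G-an2-4
gates asym, D1 and NE2/3/4.
-/

noncomputable section

namespace Summit.QuantumFields.BalabanUV.T4Continuum.SliceComplementFlatGap

open Finset WithLp
open scoped InnerProductSpace ComplexConjugate BigOperators
open Literature.MathematicalPhysics.QuantumFieldTheory.Balaban1983to89.B5Prop11Plancherel (Tor fine unitVec)
open Literature.MathematicalPhysics.QuantumFieldTheory.Balaban1983to89.B5Blocks16 (blockOf)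
open Summit.QuantumFields.BalabanUV.T4Continuum.VariationalColourFederbush (cDv Qcv)
open Summit.QuantumFields.BalabanUV.T4Continuum.VariationalColourBochner
  (Dirv Dirv_apply negLapv nsqv nsqv_nonneg ipv ipv_self conj_ipv sum_sq_translate)
open Summit.QuantumFields.BalabanUV.T4Continuum.VariationalVectorGaugeSlice
  (avgOp avgOp_apply lapOp lapOp_eq_negLapv sliceSub mem_sliceSub norm_toLp_sq)
open Summit.QuantumFields.BalabanUV.T4Continuum.CovariantBlockReversePoincare (reversePoincare revPC revPC_nonneg re_ipv_le ipv_negLapv_comm)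
open Summit.QuantumFields.BalabanUV.T4Continuum.CovariantSliceComplement
  (nsqv_negLapv_le eq_transport_blockConst_of_orth_ker norm_eq_of_orth_ker inBlock_lip_of_orth_ker ipv_lapOp_eq_zero_of_mem_orthogonal
    ipv_transport_blockConst)
open Summit.QuantumFields.BalabanUV.T4Continuum.RegularLaplacianRelativeBound (nsqv_negLapv_sub_flat_le dirichlet_le_of_ker)

variable {d : ℕ} {E : Type*} [NormedAddCommGroup E] [InnerProductSpace ℂ E] [CompleteSpace E]
variable (n : ℕ) [NeZero n] (M : Fin d → ℕ) [hM : ∀ μ, NeZero (M μ)]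

/-! ## §1 The complement `S_R(ker Q_{T′})ᗮ`: reverse Poincaré, the Laplacian, the flat comparison, the block-constant part -/

section Complement

omit [InnerProductSpace ℂ E] [CompleteSpace E] [NeZero n] hM in
/-- `√(nsqv f) = ‖toLp 2 f‖`. [folklore] -/
theorem sqrt_nsqv_eq_norm (N : Fin d → ℕ) [∀ μ, NeZero (N μ)] (f : Tor N → E) : Real.sqrt (nsqv N f) = ‖toLp 2 f‖ := by
  rw [← Real.sqrt_sq (norm_nonneg (toLp 2 f)), norm_toLp_sq]; rfl

omit [InnerProductSpace ℂ E] [CompleteSpace E] [NeZero n] hM in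
/-- from a square-sum comparison to a norm comparison: `nsqv u ≤ c²·nsqv v`, `0 ≤ c` ⟹ `‖toLp u‖ ≤ c·‖toLp v‖`. [folklore] -/
theorem norm_toLp_le_of_nsqv_le (N : Fin d → ℕ) [∀ μ, NeZero (N μ)] {u v : Tor N → E} {c : ℝ} (hc : 0 ≤ c) (h : nsqv N u ≤ c ^ 2 * nsqv N v) :
    ‖toLp 2 u‖ ≤ c * ‖toLp 2 v‖ := by
  rw [← sqrt_nsqv_eq_norm, ← sqrt_nsqv_eq_norm]
  calc Real.sqrt (nsqv N u) ≤ Real.sqrt (c ^ 2 * nsqv N v) := Real.sqrt_le_sqrt h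
    _ = c * Real.sqrt (nsqv N v) := by rw [Real.sqrt_mul' _ (nsqv_nonneg N v), Real.sqrt_sq hc]


/-- for `toLp s ∈ S_R(ker Q_{T′})ᗮ`: `div_R D_R s ⊥ ker Q_{T′}` in the function world. [folklore] -/
theorem orth_ker_of_mem_orthogonal (R : Tor (fine n M) → Fin d → (E →L[ℂ] E)) (T' : Tor (fine n M) → (E →L[ℂ] E)) {s : Tor (fine n M) → E}
    (hs : toLp 2 s ∈ (sliceSub (fine n M) R (LinearMap.ker (avgOp n M T')))ᗮ) :
    ∀ k : Tor (fine n M) → E, Qcv n M T' k = 0 → ipv (fine n M) k (negLapv (fine n M) R s) = 0 := by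
  intro k hk
  have hkK : k ∈ LinearMap.ker (avgOp n M T') := by rw [LinearMap.mem_ker, avgOp_apply, hk]
  have h := ipv_lapOp_eq_zero_of_mem_orthogonal (fine n M) R (LinearMap.ker (avgOp n M T')) hs hkK
  rwa [lapOp_eq_negLapv] at h

/-- **reverse Poincaré on the complement**: `n²·Σ_μ nsqv (D^R_μ s) ≤ C₁·nsqv s` for `toLp s ∈ S_R(ker Q_{T′})ᗮ`. [folklore] -/
theorem dirichletR_le_of_orth {T' : Tor (fine n M) → (E →L[ℂ] E)} (hT' : ∀ x, T' x ∈ unitary (E →L[ℂ] E))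
    {R : Tor (fine n M) → Fin d → (E →L[ℂ] E)} (hU : ∀ x μ, R x μ ∈ unitary (E →L[ℂ] E)) {w : ℝ} (hw0 : 0 ≤ w)
    (hw : ∀ (x : Tor (fine n M)) (μ : Fin d), blockOf n M (x + unitVec (fine n M) μ) = blockOf n M x →
      ‖R x μ * star (T' (x + unitVec (fine n M) μ)) * T' x - 1‖ ≤ w)
    {s : Tor (fine n M) → E} (hs : toLp 2 s ∈ (sliceSub (fine n M) R (LinearMap.ker (avgOp n M T')))ᗮ) :
    (n : ℝ) ^ 2 * ∑ μ, nsqv (fine n M) (Dirv (fine n M) R μ s) ≤ revPC d n w * nsqv (fine n M) s := by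
  have hR : ∀ x μ, ‖R x μ‖ ≤ 1 := fun x μ => VariationalColourFederbush.norm_le_one_of_mem_unitary (hU x μ)
  have horth := orth_ker_of_mem_orthogonal n M R T' hs
  exact reversePoincare n M hR hw0 (G := fun y => ‖Qcv n M T' (negLapv (fine n M) R s) y‖) (norm_eq_of_orth_ker n M hT' horth)
    (inBlock_lip_of_orth_ker n M hT' hw horth)

/-- **the covariant Laplacian on the complement**: `n⁴·nsqv (div_R D_R s) ≤ C₁²·nsqv s`. [folklore] -/
theorem nsqv_lapR_le_of_orth {T' : Tor (fine n M) → (E →L[ℂ] E)} (hT' : ∀ x, T' x ∈ unitary (E →L[ℂ] E))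
    {R : Tor (fine n M) → Fin d → (E →L[ℂ] E)} (hU : ∀ x μ, R x μ ∈ unitary (E →L[ℂ] E)) {w : ℝ} (hw0 : 0 ≤ w)
    (hw : ∀ (x : Tor (fine n M)) (μ : Fin d), blockOf n M (x + unitVec (fine n M) μ) = blockOf n M x →
      ‖R x μ * star (T' (x + unitVec (fine n M) μ)) * T' x - 1‖ ≤ w)
    {s : Tor (fine n M) → E} (hs : toLp 2 s ∈ (sliceSub (fine n M) R (LinearMap.ker (avgOp n M T')))ᗮ) :
    (n : ℝ) ^ 4 * nsqv (fine n M) (negLapv (fine n M) R s) ≤ revPC d n w ^ 2 * nsqv (fine n M) s := by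
  have hR : ∀ x μ, ‖R x μ‖ ≤ 1 := fun x μ => VariationalColourFederbush.norm_le_one_of_mem_unitary (hU x μ)
  have horth := orth_ker_of_mem_orthogonal n M R T' hs
  exact nsqv_negLapv_le n M hR hw0 (G := fun y => ‖Qcv n M T' (negLapv (fine n M) R s) y‖) (norm_eq_of_orth_ker n M hT' horth)
    (inBlock_lip_of_orth_ker n M hT' hw horth)

omit [CompleteSpace E] in
/-- the FLAT Dirichlet form against the covariant one (every `s`, `‖R − 1‖ ≤ a`): `Σ_μ nsqv (D¹_μ s) ≤ 2·Σ_μ nsqv (D^R_μ s) + 2d·a²·nsqv s`. [folklore] -/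
theorem dirichletFlat_le {R : Tor (fine n M) → Fin d → (E →L[ℂ] E)} {a : ℝ} (ha : ∀ x μ, ‖R x μ - 1‖ ≤ a) (s : Tor (fine n M) → E) :
    ∑ μ, nsqv (fine n M) (Dirv (fine n M) (fun (_ : Tor (fine n M)) (_ : Fin d) => (1 : E →L[ℂ] E)) μ s)
      ≤ 2 * ∑ μ, nsqv (fine n M) (Dirv (fine n M) R μ s) + 2 * d * a ^ 2 * nsqv (fine n M) s := by
  have hμ : ∀ μ, nsqv (fine n M) (Dirv (fine n M) (fun (_ : Tor (fine n M)) (_ : Fin d) => (1 : E →L[ℂ] E)) μ s)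
      ≤ 2 * nsqv (fine n M) (Dirv (fine n M) R μ s) + 2 * a ^ 2 * nsqv (fine n M) s := by
    intro μ
    have hpt : ∀ x, ‖Dirv (fine n M) (fun (_ : Tor (fine n M)) (_ : Fin d) => (1 : E →L[ℂ] E)) μ s x‖ ^ 2
        ≤ 2 * ‖Dirv (fine n M) R μ s x‖ ^ 2 + 2 * (a ^ 2 * ‖s (x + unitVec (fine n M) μ)‖ ^ 2) := by
      intro x
      have e : Dirv (fine n M) (fun (_ : Tor (fine n M)) (_ : Fin d) => (1 : E →L[ℂ] E)) μ s x
          = Dirv (fine n M) R μ s x - (R x μ - 1) (s (x + unitVec (fine n M) μ)) := by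
        simp only [Dirv_apply, sub_apply, one_apply_eq_self]; abel
      have h1 : ‖(R x μ - 1) (s (x + unitVec (fine n M) μ))‖ ≤ a * ‖s (x + unitVec (fine n M) μ)‖ :=
        (ContinuousLinearMap.le_opNorm _ _).trans (mul_le_mul_of_nonneg_right (ha x μ) (norm_nonneg _))
      have h2 : ‖Dirv (fine n M) (fun (_ : Tor (fine n M)) (_ : Fin d) => (1 : E →L[ℂ] E)) μ s x‖
          ≤ ‖Dirv (fine n M) R μ s x‖ + a * ‖s (x + unitVec (fine n M) μ)‖ := by
        rw [e]; exact (norm_sub_le _ _).trans (add_le_add le_rfl h1)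
      have h0 := norm_nonneg (Dirv (fine n M) (fun (_ : Tor (fine n M)) (_ : Fin d) => (1 : E →L[ℂ] E)) μ s x)
      have hY := norm_nonneg (Dirv (fine n M) R μ s x)
      have hZ : 0 ≤ a * ‖s (x + unitVec (fine n M) μ)‖ := le_trans (norm_nonneg _) h1
      have h3 := mul_le_mul h2 h2 h0 (by positivity)
      nlinarith [h3, sq_nonneg (‖Dirv (fine n M) R μ s x‖ - a * ‖s (x + unitVec (fine n M) μ)‖)]
    unfold nsqv
    calc ∑ x, ‖Dirv (fine n M) (fun (_ : Tor (fine n M)) (_ : Fin d) => (1 : E →L[ℂ] E)) μ s x‖ ^ 2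
        ≤ ∑ x, (2 * ‖Dirv (fine n M) R μ s x‖ ^ 2 + 2 * (a ^ 2 * ‖s (x + unitVec (fine n M) μ)‖ ^ 2)) := sum_le_sum fun x _ => hpt x
      _ = 2 * ∑ x, ‖Dirv (fine n M) R μ s x‖ ^ 2 + 2 * a ^ 2 * ∑ x, ‖s (x + unitVec (fine n M) μ)‖ ^ 2 := by
          rw [sum_add_distrib, ← mul_sum, ← mul_sum, ← mul_sum, mul_assoc]
      _ = _ := by rw [sum_sq_translate]
  calc _ ≤ ∑ μ : Fin d, (2 * nsqv (fine n M) (Dirv (fine n M) R μ s) + 2 * a ^ 2 * nsqv (fine n M) s) := sum_le_sum fun μ _ => hμ μ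
    _ = _ := by rw [sum_add_distrib, ← mul_sum, sum_const, card_univ, Fintype.card_fin, nsmul_eq_mul]; ring

/-- the gap's second-order constant `E₁ = 12d·α²·C₁ + 12d²·α⁴ + 3d²·(α² + λ)²` (`α = na`, `λ = n²ℓ`, `C₁ = revPC d n w`). [folklore] -/
def gapE (d n : ℕ) (a ℓ w : ℝ) : ℝ :=
  12 * d * ((n : ℝ) * a) ^ 2 * revPC d n w + 12 * (d : ℝ) ^ 2 * ((n : ℝ) * a) ^ 4 + 3 * (d : ℝ) ^ 2 * (((n : ℝ) * a) ^ 2 + (n : ℝ) ^ 2 * ℓ) ^ 2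

omit [NeZero n] in
/-- `0 ≤ E₁`. [folklore] -/
theorem gapE_nonneg (a ℓ w : ℝ) : 0 ≤ gapE d n a ℓ w := by
  have := revPC_nonneg (d := d) n w
  unfold gapE; positivity

/-- **`div_R D_R − Δ` on the complement**: `n⁴·nsqv ((div_R D_R − Δ) s) ≤ E₁·nsqv s` for `toLp s ∈ S_R(ker Q_{T′})ᗮ`. [folklore] -/
theorem nsqv_lapSubFlat_le_of_orth {T' : Tor (fine n M) → (E →L[ℂ] E)} (hT' : ∀ x, T' x ∈ unitary (E →L[ℂ] E))
    {R : Tor (fine n M) → Fin d → (E →L[ℂ] E)} (hU : ∀ x μ, R x μ ∈ unitary (E →L[ℂ] E)) {a ℓ w : ℝ}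
    (ha : ∀ x μ, ‖R x μ - 1‖ ≤ a) (hℓ : ∀ x μ, ‖R x μ - R (x - unitVec (fine n M) μ) μ‖ ≤ ℓ) (hw0 : 0 ≤ w)
    (hw : ∀ (x : Tor (fine n M)) (μ : Fin d), blockOf n M (x + unitVec (fine n M) μ) = blockOf n M x →
      ‖R x μ * star (T' (x + unitVec (fine n M) μ)) * T' x - 1‖ ≤ w)
    {s : Tor (fine n M) → E} (hs : toLp 2 s ∈ (sliceSub (fine n M) R (LinearMap.ker (avgOp n M T')))ᗮ) :
    (n : ℝ) ^ 4 * nsqv (fine n M) (negLapv (fine n M) R s - negLapv (fine n M) (fun (_ : Tor (fine n M)) (_ : Fin d) => (1 : E →L[ℂ] E)) s)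
      ≤ gapE d n a ℓ w * nsqv (fine n M) s := by
  set A := ∑ μ, nsqv (fine n M) (Dirv (fine n M) R μ s) with hA
  set U := nsqv (fine n M) s with hU'
  have hA0 : 0 ≤ A := sum_nonneg fun μ _ => nsqv_nonneg _ _
  have hU0 : 0 ≤ U := nsqv_nonneg _ _
  have h1 := nsqv_negLapv_sub_flat_le (fine n M) hU ha hℓ s
  have h2 := dirichletFlat_le n M ha s
  have h3 : (n : ℝ) ^ 2 * A ≤ revPC d n w * U := dirichletR_le_of_orth n M hT' hU hw0 hw hs
  have hd : (0 : ℝ) ≤ d := Nat.cast_nonneg d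
  -- `nsqv (…) ≤ 6da²(2A + 2da²U) + 3d²(a²+ℓ)²U`
  have h4 : nsqv (fine n M) (negLapv (fine n M) R s - negLapv (fine n M) (fun (_ : Tor (fine n M)) (_ : Fin d) => (1 : E →L[ℂ] E)) s)
      ≤ 6 * d * a ^ 2 * (2 * A + 2 * d * a ^ 2 * U) + 3 * (d : ℝ) ^ 2 * (a ^ 2 + ℓ) ^ 2 * U :=
    h1.trans (add_le_add (mul_le_mul_of_nonneg_left h2 (by positivity)) le_rfl)
  have h5 : (n : ℝ) ^ 4 * (6 * d * a ^ 2 * (2 * A + 2 * d * a ^ 2 * U) + 3 * (d : ℝ) ^ 2 * (a ^ 2 + ℓ) ^ 2 * U)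
      = 12 * d * ((n : ℝ) * a) ^ 2 * ((n : ℝ) ^ 2 * A) + (12 * (d : ℝ) ^ 2 * ((n : ℝ) * a) ^ 4 + 3 * (d : ℝ) ^ 2 * (((n : ℝ) * a) ^ 2 + (n : ℝ) ^ 2 * ℓ) ^ 2) * U := by
    ring
  have h6 : 12 * d * ((n : ℝ) * a) ^ 2 * ((n : ℝ) ^ 2 * A) ≤ 12 * d * ((n : ℝ) * a) ^ 2 * (revPC d n w * U) :=
    mul_le_mul_of_nonneg_left h3 (by positivity)
  calc (n : ℝ) ^ 4 * nsqv (fine n M) (negLapv (fine n M) R s - negLapv (fine n M) (fun (_ : Tor (fine n M)) (_ : Fin d) => (1 : E →L[ℂ] E)) s)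
      ≤ (n : ℝ) ^ 4 * (6 * d * a ^ 2 * (2 * A + 2 * d * a ^ 2 * U) + 3 * (d : ℝ) ^ 2 * (a ^ 2 + ℓ) ^ 2 * U) := mul_le_mul_of_nonneg_left h4 (by positivity)
    _ ≤ 12 * d * ((n : ℝ) * a) ^ 2 * (revPC d n w * U) + (12 * (d : ℝ) ^ 2 * ((n : ℝ) * a) ^ 4 + 3 * (d : ℝ) ^ 2 * (((n : ℝ) * a) ^ 2 + (n : ℝ) ^ 2 * ℓ) ^ 2) * U := by
        rw [h5]; exact add_le_add h6 le_rfl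
    _ = gapE d n a ℓ w * U := by unfold gapE; ring

/-- **the covariantly block-constant Laplacian is `τ`-close to its block-constant part**: with `f := div_R D_R s = T′⋆ c(block ·)` (`c = Q_{T′} f`) and
`‖T′ − 1‖ ≤ τ`, `nsqv (f − c(block ·)) ≤ τ²·nsqv f`. [folklore] -/
theorem nsqv_sub_blockConst_le_of_orth {T' : Tor (fine n M) → (E →L[ℂ] E)} (hT' : ∀ x, T' x ∈ unitary (E →L[ℂ] E)) {τ : ℝ}
    (hτ : ∀ x, ‖T' x - 1‖ ≤ τ) (R : Tor (fine n M) → Fin d → (E →L[ℂ] E))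
    {s : Tor (fine n M) → E} (hs : toLp 2 s ∈ (sliceSub (fine n M) R (LinearMap.ker (avgOp n M T')))ᗮ) :
    nsqv (fine n M) (negLapv (fine n M) R s - fun x => Qcv n M T' (negLapv (fine n M) R s) (blockOf n M x))
      ≤ τ ^ 2 * nsqv (fine n M) (negLapv (fine n M) R s) := by
  have horth := orth_ker_of_mem_orthogonal n M R T' hs
  have hform := eq_transport_blockConst_of_orth_ker n M hT' horth
  have hnorm := norm_eq_of_orth_ker n M hT' horth
  have hpt : ∀ x, ‖(negLapv (fine n M) R s - fun x => Qcv n M T' (negLapv (fine n M) R s) (blockOf n M x)) x‖ ^ 2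
      ≤ τ ^ 2 * ‖negLapv (fine n M) R s x‖ ^ 2 := by
    intro x
    have h1 : negLapv (fine n M) R s x = star (T' x) (Qcv n M T' (negLapv (fine n M) R s) (blockOf n M x)) := by
      have h := congrFun hform x
      simpa using h
    have e : (negLapv (fine n M) R s - fun x => Qcv n M T' (negLapv (fine n M) R s) (blockOf n M x)) x
        = (star (T' x) - 1) (Qcv n M T' (negLapv (fine n M) R s) (blockOf n M x)) := by
      rw [Pi.sub_apply, sub_apply, one_apply_eq_self]
      exact congrArg (fun v => v - Qcv n M T' (negLapv (fine n M) R s) (blockOf n M x)) h1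
    have hst : ‖star (T' x) - 1‖ ≤ τ := by
      rw [← star_one, ← star_sub, norm_star]; exact hτ x
    have h2 : ‖(negLapv (fine n M) R s - fun x => Qcv n M T' (negLapv (fine n M) R s) (blockOf n M x)) x‖ ≤ τ * ‖negLapv (fine n M) R s x‖ := by
      rw [e, hnorm x]
      exact (ContinuousLinearMap.le_opNorm _ _).trans (mul_le_mul_of_nonneg_right hst (norm_nonneg _))
    have h0 := norm_nonneg ((negLapv (fine n M) R s - fun x => Qcv n M T' (negLapv (fine n M) R s) (blockOf n M x)) x)
    have h3 := mul_le_mul h2 h2 h0 (h0.trans h2)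
    nlinarith [h3]
  unfold nsqv
  rw [mul_sum]
  exact sum_le_sum fun x _ => hpt x

/-- a block-constant field is `ℓ²`-orthogonal to `ker Q′_1`. [folklore] -/
theorem ipv_blockConst_eq_zero {k : Tor (fine n M) → E} (hk : Qcv n M (fun _ => (1 : E →L[ℂ] E)) k = 0) (c : Tor M → E) :
    ipv (fine n M) (fun x => c (blockOf n M x)) k = 0 := by
  have e : (fun x => c (blockOf n M x)) = fun x => star ((fun _ => (1 : E →L[ℂ] E)) x) (c (blockOf n M x)) := by
    funext x; simp
  have h : ipv (fine n M) k (fun x => c (blockOf n M x)) = 0 := by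
    rw [e, ipv_transport_blockConst, hk]
    simp
  rw [← conj_ipv, h, map_zero]

end Complement

/-! ## §2 The pairing `Re⟪s, Δk⟫` for `s` in the covariant complement and `k ∈ ker Q′_1` -/

variable [FiniteDimensional ℂ E]

section Pairing

/-- the one-sided gap constant `δ₀ = 4·(τ·C₁ + √E₁)`. [folklore] -/
def deltaGap (d n : ℕ) (a ℓ τ w : ℝ) : ℝ := 4 * (τ * revPC d n w + Real.sqrt (gapE d n a ℓ w))

omit [NeZero n] in
/-- `0 ≤ δ₀` for `0 ≤ τ`. [folklore] -/
theorem deltaGap_nonneg {a ℓ τ w : ℝ} (hτ : 0 ≤ τ) : 0 ≤ deltaGap d n a ℓ τ w := by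
  have := revPC_nonneg (d := d) n w
  unfold deltaGap; positivity

/-- **THE PAIRING BOUND**: for `toLp s ∈ S_R(ker Q_{T′})ᗮ` and `Q′_1 k = 0`,
`Re⟪toLp s, toLp (Δ k)⟫ ≤ δ₀·‖toLp s‖·‖toLp (Δ k)‖` — `Δs = c(block ·) + r`, `c(block ·) ⊥ k`, `n²‖r‖ ≤ (τC₁ + √E₁)‖s‖`, `‖k‖ ≤ 4n²‖Δk‖`. [folklore] -/
theorem re_inner_lapFlat_le_of_orth {T' : Tor (fine n M) → (E →L[ℂ] E)} (hT' : ∀ x, T' x ∈ unitary (E →L[ℂ] E)) {τ : ℝ}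
    (hτ : ∀ x, ‖T' x - 1‖ ≤ τ)
    {R : Tor (fine n M) → Fin d → (E →L[ℂ] E)} (hU : ∀ x μ, R x μ ∈ unitary (E →L[ℂ] E)) {a ℓ w : ℝ}
    (ha : ∀ x μ, ‖R x μ - 1‖ ≤ a) (hℓ : ∀ x μ, ‖R x μ - R (x - unitVec (fine n M) μ) μ‖ ≤ ℓ) (hw0 : 0 ≤ w)
    (hw : ∀ (x : Tor (fine n M)) (μ : Fin d), blockOf n M (x + unitVec (fine n M) μ) = blockOf n M x →
      ‖R x μ * star (T' (x + unitVec (fine n M) μ)) * T' x - 1‖ ≤ w)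
    {s : Tor (fine n M) → E} (hs : toLp 2 s ∈ (sliceSub (fine n M) R (LinearMap.ker (avgOp n M T')))ᗮ)
    {k : Tor (fine n M) → E} (hk : Qcv n M (fun _ => (1 : E →L[ℂ] E)) k = 0) :
    (⟪toLp 2 s, toLp 2 (negLapv (fine n M) (fun (_ : Tor (fine n M)) (_ : Fin d) => (1 : E →L[ℂ] E)) k)⟫_ℂ).re
      ≤ deltaGap d n a ℓ τ w * ‖toLp 2 s‖ * ‖toLp 2 (negLapv (fine n M) (fun (_ : Tor (fine n M)) (_ : Fin d) => (1 : E →L[ℂ] E)) k)‖ := by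
  have hn : (0 : ℝ) < n := by exact_mod_cast Nat.pos_of_ne_zero (NeZero.ne n)
  have hτ0 : 0 ≤ τ := (norm_nonneg _).trans (hτ 0)
  have hC := revPC_nonneg (d := d) n w
  have hE := gapE_nonneg (d := d) n a ℓ w
  -- the pairing is `Re ipv r k`, `r := Δs − c(block ·)`
  have e1 : ⟪toLp 2 s, toLp 2 (negLapv (fine n M) (fun (_ : Tor (fine n M)) (_ : Fin d) => (1 : E →L[ℂ] E)) k)⟫_ℂ
      = ipv (fine n M) s (negLapv (fine n M) (fun (_ : Tor (fine n M)) (_ : Fin d) => (1 : E →L[ℂ] E)) k) := rfl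
  have e2 := ipv_negLapv_comm (fine n M) (fun (_ : Tor (fine n M)) (_ : Fin d) => (1 : E →L[ℂ] E)) s k
  have e3 : ipv (fine n M) (negLapv (fine n M) (fun (_ : Tor (fine n M)) (_ : Fin d) => (1 : E →L[ℂ] E)) s) k
      = ipv (fine n M) (fun x => Qcv n M T' (negLapv (fine n M) R s) (blockOf n M x)) k
        + ipv (fine n M) (negLapv (fine n M) (fun (_ : Tor (fine n M)) (_ : Fin d) => (1 : E →L[ℂ] E)) s
            - fun x => Qcv n M T' (negLapv (fine n M) R s) (blockOf n M x)) k := by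
    unfold ipv; rw [← sum_add_distrib]
    exact sum_congr rfl fun x _ => by rw [← inner_add_left, Pi.sub_apply, add_sub_cancel]
  have e4 : ipv (fine n M) (fun x => Qcv n M T' (negLapv (fine n M) R s) (blockOf n M x)) k = 0 :=
    ipv_blockConst_eq_zero n M hk _
  have hpair : (⟪toLp 2 s, toLp 2 (negLapv (fine n M) (fun (_ : Tor (fine n M)) (_ : Fin d) => (1 : E →L[ℂ] E)) k)⟫_ℂ).re
      = (ipv (fine n M) (negLapv (fine n M) (fun (_ : Tor (fine n M)) (_ : Fin d) => (1 : E →L[ℂ] E)) s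
            - fun x => Qcv n M T' (negLapv (fine n M) R s) (blockOf n M x)) k).re := by
    rw [e1, e2, e3, e4, zero_add]
  -- `r = (Δs − div_R D_R s) + (div_R D_R s − c(block ·))`
  have hr_split : toLp 2 (negLapv (fine n M) (fun (_ : Tor (fine n M)) (_ : Fin d) => (1 : E →L[ℂ] E)) s
        - fun x => Qcv n M T' (negLapv (fine n M) R s) (blockOf n M x))
      = toLp 2 (negLapv (fine n M) (fun (_ : Tor (fine n M)) (_ : Fin d) => (1 : E →L[ℂ] E)) s - negLapv (fine n M) R s)
        + toLp 2 (negLapv (fine n M) R s - fun x => Qcv n M T' (negLapv (fine n M) R s) (blockOf n M x)) := by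
    rw [← WithLp.toLp_add, sub_add_sub_cancel]
  -- `‖Δs − div_R D_R s‖ ≤ (√E₁/n²)·‖s‖`
  have hb1 : ‖toLp 2 (negLapv (fine n M) (fun (_ : Tor (fine n M)) (_ : Fin d) => (1 : E →L[ℂ] E)) s - negLapv (fine n M) R s)‖
      ≤ Real.sqrt (gapE d n a ℓ w) / (n : ℝ) ^ 2 * ‖toLp 2 s‖ := by
    refine norm_toLp_le_of_nsqv_le (fine n M) (by positivity) ?_
    have h := nsqv_lapSubFlat_le_of_orth n M hT' hU ha hℓ hw0 hw hs
    have e : nsqv (fine n M) (negLapv (fine n M) (fun (_ : Tor (fine n M)) (_ : Fin d) => (1 : E →L[ℂ] E)) s - negLapv (fine n M) R s)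
        = nsqv (fine n M) (negLapv (fine n M) R s - negLapv (fine n M) (fun (_ : Tor (fine n M)) (_ : Fin d) => (1 : E →L[ℂ] E)) s) := by
      unfold nsqv; exact sum_congr rfl fun x _ => by rw [Pi.sub_apply, Pi.sub_apply, norm_sub_rev]
    rw [e, div_pow, Real.sq_sqrt hE, ← pow_mul, show 2 * 2 = 4 by norm_num, div_mul_eq_mul_div, le_div_iff₀ (by positivity), mul_comm]
    exact h
  -- `‖div_R D_R s − c(block ·)‖ ≤ τ·(C₁/n²)·‖s‖`
  have hb2 : ‖toLp 2 (negLapv (fine n M) R s - fun x => Qcv n M T' (negLapv (fine n M) R s) (blockOf n M x))‖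
      ≤ τ * (revPC d n w / (n : ℝ) ^ 2) * ‖toLp 2 s‖ := by
    have h1 : ‖toLp 2 (negLapv (fine n M) R s - fun x => Qcv n M T' (negLapv (fine n M) R s) (blockOf n M x))‖
        ≤ τ * ‖toLp 2 (negLapv (fine n M) R s)‖ :=
      norm_toLp_le_of_nsqv_le (fine n M) hτ0 (nsqv_sub_blockConst_le_of_orth n M hT' hτ R hs)
    have h2 : ‖toLp 2 (negLapv (fine n M) R s)‖ ≤ revPC d n w / (n : ℝ) ^ 2 * ‖toLp 2 s‖ := by
      refine norm_toLp_le_of_nsqv_le (fine n M) (by positivity) ?_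
      have h := nsqv_lapR_le_of_orth n M hT' hU hw0 hw hs
      rw [div_pow, ← pow_mul, show 2 * 2 = 4 by norm_num, div_mul_eq_mul_div, le_div_iff₀ (by positivity), mul_comm]
      exact h
    calc _ ≤ τ * ‖toLp 2 (negLapv (fine n M) R s)‖ := h1
      _ ≤ τ * (revPC d n w / (n : ℝ) ^ 2 * ‖toLp 2 s‖) := mul_le_mul_of_nonneg_left h2 hτ0
      _ = _ := by ring
  have hrle : ‖toLp 2 (negLapv (fine n M) (fun (_ : Tor (fine n M)) (_ : Fin d) => (1 : E →L[ℂ] E)) s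
        - fun x => Qcv n M T' (negLapv (fine n M) R s) (blockOf n M x))‖
      ≤ (τ * revPC d n w + Real.sqrt (gapE d n a ℓ w)) / (n : ℝ) ^ 2 * ‖toLp 2 s‖ := by
    rw [hr_split]
    calc _ ≤ _ := norm_add_le _ _
      _ ≤ Real.sqrt (gapE d n a ℓ w) / (n : ℝ) ^ 2 * ‖toLp 2 s‖ + τ * (revPC d n w / (n : ℝ) ^ 2) * ‖toLp 2 s‖ := add_le_add hb1 hb2
      _ = _ := by ring
  -- `‖k‖ ≤ 4n²‖Δk‖`
  have hkle : ‖toLp 2 k‖ ≤ 4 * (n : ℝ) ^ 2 * ‖toLp 2 (negLapv (fine n M) (fun (_ : Tor (fine n M)) (_ : Fin d) => (1 : E →L[ℂ] E)) k)‖ := by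
    refine norm_toLp_le_of_nsqv_le (fine n M) (by positivity) ?_
    have h := (dirichlet_le_of_ker n M hk).2
    calc _ ≤ _ := h
      _ = _ := by ring
  -- Cauchy–Schwarz for the pairing
  have hcs : (ipv (fine n M) (negLapv (fine n M) (fun (_ : Tor (fine n M)) (_ : Fin d) => (1 : E →L[ℂ] E)) s
          - fun x => Qcv n M T' (negLapv (fine n M) R s) (blockOf n M x)) k).re
      ≤ ‖toLp 2 (negLapv (fine n M) (fun (_ : Tor (fine n M)) (_ : Fin d) => (1 : E →L[ℂ] E)) s
          - fun x => Qcv n M T' (negLapv (fine n M) R s) (blockOf n M x))‖ * ‖toLp 2 k‖ := by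
    rw [← sqrt_nsqv_eq_norm, ← sqrt_nsqv_eq_norm]; exact re_ipv_le (fine n M) _ k
  rw [hpair]
  calc _ ≤ _ := hcs
    _ ≤ ((τ * revPC d n w + Real.sqrt (gapE d n a ℓ w)) / (n : ℝ) ^ 2 * ‖toLp 2 s‖)
          * (4 * (n : ℝ) ^ 2 * ‖toLp 2 (negLapv (fine n M) (fun (_ : Tor (fine n M)) (_ : Fin d) => (1 : E →L[ℂ] E)) k)‖) :=
        mul_le_mul hrle hkle (norm_nonneg _) (by positivity)
    _ = _ := by unfold deltaGap; field_simp

end Pairing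

/-! ## §3 THE END: the flat slice subspace is one-sidedly `δ₀`-close to the covariant one -/

section End

/-- **THE ONE-SIDED CLOSENESS OF THE SLICE SUBSPACES FOR COVARIANT FRAMES** (model level; general finite-dimensional Hilbert `E`): unitary bond transports
`R` in a regular small gauge (`‖R − 1‖ ≤ a`, `‖R(x,μ) − R(x−e_μ,μ)‖ ≤ ℓ`), ANY unitary frame field `T′` with `‖T′ − 1‖ ≤ τ` and the in-block mismatch
class `‖R(x,μ)T′(x+e_μ)⋆T′(x) − 1‖ ≤ w`.  Then every flat slice vector `y ∈ S_1(ker Q′_1) = Δ(ker Q′_1)` satisfies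

  `‖y − Π_{S_R(ker Q_{T′})} y‖ ≤ δ₀ · ‖y‖`,  `δ₀ = deltaGap d n a ℓ τ w = 4·(τ·C₁ + √(12d(na)²C₁ + 12d²(na)⁴ + 3d²((na)² + n²ℓ)²))`, `C₁ = 4d·36^d(1 + nw)²`

— UNIFORM in `n` in the classes `na ≤ α₀`, `n²ℓ ≤ λ₀`, `nw ≤ w₀`; the `h` hypothesis of `SubspacePairPerturbation.norm_sub_starProjection_le_of_oneSided` and of
§1's `norm_starProjection_le_of_oneSided'` with `S := S_1(ker Q′_1)`, `S′ := S_R(ker Q_{T′})`. [folklore] -/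
theorem sliceFlat_close_covariant {T' : Tor (fine n M) → (E →L[ℂ] E)} (hT' : ∀ x, T' x ∈ unitary (E →L[ℂ] E)) {τ : ℝ}
    (hτ : ∀ x, ‖T' x - 1‖ ≤ τ)
    {R : Tor (fine n M) → Fin d → (E →L[ℂ] E)} (hU : ∀ x μ, R x μ ∈ unitary (E →L[ℂ] E)) {a ℓ w : ℝ}
    (ha : ∀ x μ, ‖R x μ - 1‖ ≤ a) (hℓ : ∀ x μ, ‖R x μ - R (x - unitVec (fine n M) μ) μ‖ ≤ ℓ) (hw0 : 0 ≤ w)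
    (hw : ∀ (x : Tor (fine n M)) (μ : Fin d), blockOf n M (x + unitVec (fine n M) μ) = blockOf n M x →
      ‖R x μ * star (T' (x + unitVec (fine n M) μ)) * T' x - 1‖ ≤ w) :
    ∀ y ∈ sliceSub (fine n M) (fun (_ : Tor (fine n M)) (_ : Fin d) => (1 : E →L[ℂ] E))
        (LinearMap.ker (avgOp n M (fun _ => (1 : E →L[ℂ] E)))),
      ‖y - (sliceSub (fine n M) R (LinearMap.ker (avgOp n M T'))).starProjection y‖ ≤ deltaGap d n a ℓ τ w * ‖y‖ := by
  intro y hy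
  have hτ0 : 0 ≤ τ := (norm_nonneg _).trans (hτ 0)
  have hδ := deltaGap_nonneg (d := d) n (a := a) (ℓ := ℓ) (w := w) hτ0
  -- `y = toLp (Δ k)` with `Q′_1 k = 0`
  rw [mem_sliceSub, Submodule.mem_map] at hy
  obtain ⟨k, hkK, hky⟩ := hy
  have hk : Qcv n M (fun _ => (1 : E →L[ℂ] E)) k = 0 := by
    have := LinearMap.mem_ker.mp hkK
    rwa [avgOp_apply] at this
  have ey : y = toLp 2 (negLapv (fine n M) (fun (_ : Tor (fine n M)) (_ : Fin d) => (1 : E →L[ℂ] E)) k) := by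
    rw [← lapOp_eq_negLapv, hky, toLp_ofLp]
  -- the residual `q = y − Π y ∈ S_Rᗮ`
  set q := y - (sliceSub (fine n M) R (LinearMap.ker (avgOp n M T'))).starProjection y with hq
  have hq_orth : q ∈ (sliceSub (fine n M) R (LinearMap.ker (avgOp n M T')))ᗮ := Submodule.sub_starProjection_mem_orthogonal y
  have hs : toLp 2 (ofLp q) ∈ (sliceSub (fine n M) R (LinearMap.ker (avgOp n M T')))ᗮ := by rw [toLp_ofLp]; exact hq_orth
  -- `‖q‖² = Re⟪q, y⟫ ≤ δ₀‖q‖‖y‖`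
  have h1 : ‖q‖ ^ 2 = (⟪q, y⟫_ℂ).re := by
    have e : ⟪q, q⟫_ℂ = ⟪q, y⟫_ℂ := by
      rw [hq, inner_sub_right, Submodule.inner_left_of_mem_orthogonal (Submodule.starProjection_apply_mem _ y) hq_orth, sub_zero]
    rw [norm_sq_eq_re_inner (𝕜 := ℂ), e]; rfl
  have h2 : (⟪q, y⟫_ℂ).re ≤ deltaGap d n a ℓ τ w * ‖q‖ * ‖y‖ := by
    have h := re_inner_lapFlat_le_of_orth n M hT' hτ hU ha hℓ hw0 hw hs hk
    rw [toLp_ofLp, ← ey] at h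
    exact h
  have h3 : ‖q‖ * ‖q‖ ≤ (deltaGap d n a ℓ τ w * ‖y‖) * ‖q‖ := by rw [← sq, h1]; linarith [h2]
  rcases (norm_nonneg q).eq_or_lt with hq0 | hqpos
  · rw [← hq0]; positivity
  · exact le_of_mul_le_mul_right h3 hqpos

end End

end Summit.QuantumFields.BalabanUV.T4Continuum.SliceComplementFlatGap

end
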